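import Literature.MathematicalPhysics.QuantumFieldTheory.BalabanImbrieJaffe1984to88.BIJ88RestrictionsL1Decay308
import Literature.MathematicalPhysics.QuantumFieldTheory.BalabanImbrieJaffe1984to88.BIJ88GaussShellNoncentred309

/-!
# `BalabanImbrieJaffe1984to88.BIJ88EffectiveActionL1Remainder308` — T. Bałaban, J. Imbrie, A. Jaffe, *Effective action and cluster properties of
the abelian Higgs model*, Commun. Math. Phys. **114** (1988) 257–315 [BalabanImbrieJaffe1988], Sect. 5.14 p. 308 [PDF 52]: *"Thus we define
perturbative terms for the action, 𝒫̃_{k+1}(Λ₁₂^{(k)}) = Σ_{α=1}^{n̄} −(1/α!)(dᵅ/dtᵅ) log z_t(Λ₁₂^{(k)})|_{t=0}, (5.14.1) and a remainder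
ℛ_k(Λ₁₂^{(k)}) = ∫₀¹ dt −((1−t)^{n̄}/(n̄+1)!) ⟨d/dt; …; d/dt⟩_t. (5.14.2) … The effective action is computed from the formula
−log z₁(Λ₁₂^{(k)}) = 𝒫̃_{k+1}(Λ₁₂^{(k)}) + ℛ_k(Λ₁₂^{(k)})"* — **THE gen-8 FORM OF (5.14.1)–(5.14.2) (`−log z₁ = pertPart n̄ (cgf_{−Ṽ}) − ∫₀¹ ((1−t)^{n̄}/n̄!)
(d/dt)^{n̄+1} log z_t dt`, proper integral of the ORDINARY `(n̄+1)`-st derivative) UNDER THE p. 309 L¹ HYPOTHESIS AND FOR NON-CENTRED GAUSSIAN FIELDS**: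
gen 8's `BIJ88EffectiveAction308.effectiveAction_restrictedInteraction` / `integrableOn_remainderDensity` / `tendsto_remainder_restrictedInteraction'`
carried CENTRED Gaussian marginals; here the same three statements follow from `hL1` (`BIJ88RestrictionsL1Decay308`), hence for Gaussian fields of
ANY means (`BIJ88GaussShellNoncentred309`).

statement-level skeleton of published theorems with citation tags; proofs where landed; nothing here is a claim about the Yang–Mills mass gap

PDF held: `paper:balaban1988-cmp114-bij-abelian-higgs-effective-action` (journal page = PDF page + 256); p. 308 = PDF 52 (`p0052.txt` L19–27).

WHAT IS REPRODUCED (unit `lit-balaban-p36`, generation 12 of the Phase-2 proof seat p36, file 5; SKELETON row **C2.Eq5.14.1-5.14.2** ((5.14.1)–(5.14.2),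
member) of `HOME/lit-balaban-r16/ROWS-C2-part2.md`, owner r16, head untouched; HOME `run/shared/lean/pub/lit-balaban/`).  Theorems only (0 definitions,
0 `Prop` facts), for the restricted interacting family `z(t) = ∫ χ′_{Λ,t} e^{−tW} dP` (probability measure, measurable fields, `c_b ≥ c₀ > 0`, `p > 0`,
measurable `|W| ≤ K`, `0 < e_k < e^{−1}`):
* §1 UNDER `hL1` AND `z_t ≠ 0` ON `(0,1]`: **`integrableOn_remainderDensity_of_L1`** (the remainder density `((1−t)^{n̄}/n̄!)(d/dt)^{n̄+1} log z_t` is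
  integrable on `[0,1]`), **`effectiveAction_restrictedInteraction_of_L1`** (`−log z₁ = pertPart n̄ (cgf_{−W}) − ∫₀¹ ((1−t)^{n̄}/n̄!)(d/dt)^{n̄+1} log z_t dt`),
  `tendsto_remainder_restrictedInteraction_of_L1` (the improper form: `∫_a^1 … → log z₁ + pertPart n̄ (cgf_{−W})` as `a → 0⁺`).
* §2 NON-CENTRED GAUSSIAN FIELDS: `…_of_hasGaussianLaw` (Gaussian-law marginals of ANY means + `z_t ≠ 0` on `(0,1]`, `p > 1/2`) and `…_of_mean`
  (`χ ≥ 0`, jointly Gaussian fields with means in the small-field box `|E Φ_b| < (9/10)c₀`: NO standing hypothesis) — gen 8's three theorems with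
  `h0` deleted.
HONEST SCOPE: sign bookkeeping as in gen 8 (print's `𝒫_{k+1}` IS `pertPart n̄`; the displayed integral with a minus in front is `−ℛ_k` up to the
located `(n̄+1)!`/`n̄!` slip GAPS G-C2-p36-06).  0 `sorry`, 0 definitions, 0 new `Prop` facts (D-0026); imports `BIJ88RestrictionsL1Decay308` and
`BIJ88GaussShellNoncentred309` (both p36 g12); modifies nothing.  NOT summit progress; NOT continuum; NOT Clay.  Cell `lit-balaban` Phase 2, seat p36
gen 12 (owner r16, referee ref-5).
-/

namespace Literature.MathematicalPhysics.QuantumFieldTheory.BalabanImbrieJaffe1984to88.BIJ88EffectiveActionL1Remainder308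

open MeasureTheory ProbabilityTheory Filter Set intervalIntegral
open scoped Nat Topology
open BIJ88Sect2Statements (pLog)
open BIJ88Sect5Statements (CutoffProfile cutoff)
open BIJ88Perturbative341 (pertPart)
open BIJ88RestrictionsL1Decay308 (tendsto_iteratedDeriv_log_restrictedInteraction_cgf_of_L1 taylor_logz_restrictedInteraction_of_L1
  pertP_restrictedInteraction_of_L1)
open BIJ88GaussShellNoncentred309 (tendsto_integral_abs_iteratedDeriv_prod_cutoff_t_zero_of_hasGaussianLaw
  integral_restrictedInteraction_ne_zero_Ioc_of_mean)

/-! ## §1 Under the L¹ hypothesis -/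

section L1

variable (χ : CutoffProfile) {ι Ω : Type*} [MeasurableSpace Ω]

/-- **The remainder density of (5.14.2) is integrable on `[0,1]`, under `hL1`**: `t ↦ ((1−t)^{n̄}/n̄!)·(d/dt)^{n̄+1} log z_t` is continuous on `(0,1]`
(gen 8) with the finite limit `(1/n̄!)·κ_{n̄+1}(−W)` at `0⁺` (`BIJ88RestrictionsL1Decay308.tendsto_iteratedDeriv_log_restrictedInteraction_cgf_of_L1`) —
gen 8's `BIJ88EffectiveAction308.integrableOn_remainderDensity` with the centred-Gaussian input replaced by `hL1`.
[cite: BalabanImbrieJaffe1988, (5.14.2) p.308] -/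
theorem integrableOn_remainderDensity_of_L1 {p : ℝ} (hp : 0 < p) (P : Measure Ω) [IsProbabilityMeasure P]
    (B : Finset ι) {Φ : ι → Ω → ℝ} (hΦ : ∀ b ∈ B, Measurable (Φ b)) {c : ι → ℝ} {c₀ : ℝ} (hc₀ : 0 < c₀) (hcb : ∀ b ∈ B, c₀ ≤ c b)
    {W : Ω → ℝ} (hW : Measurable W) {K : ℝ} (hK : ∀ ω, |W ω| ≤ K) {ek : ℝ} (hek : 0 < ek) (hek1 : ek < Real.exp (-1))
    (hz : ∀ t ∈ Set.Ioc (0 : ℝ) 1, (∫ ω, (∏ b ∈ B, cutoff χ (c b * pLog p (t * ek)) (Φ b ω)) * Real.exp (-(t * W ω)) ∂P) ≠ 0)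
    (hL1 : ∀ i, 1 ≤ i → Tendsto (fun t => ∫ ω, |iteratedDeriv i (fun s => ∏ b ∈ B, cutoff χ (c b * pLog p (s * ek)) (Φ b ω)) t| ∂P)
      (𝓝[>] (0 : ℝ)) (𝓝 0)) (nbar : ℕ) :
    IntegrableOn (fun t => ((1 - t) ^ nbar / (nbar ! : ℝ)) * iteratedDeriv (nbar + 1) (fun t => Real.log
        (∫ ω, (∏ b ∈ B, cutoff χ (c b * pLog p (t * ek)) (Φ b ω)) * Real.exp (-(t * W ω)) ∂P)) t) (uIcc (0 : ℝ) 1) := by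
  have hcpos : ∀ b ∈ B, 0 < c b := fun b hb => hc₀.trans_le (hcb b hb)
  have hcne : ∀ b ∈ B, c b ≠ 0 := fun b hb => (hcpos b hb).ne'
  have hpoly : Continuous fun t : ℝ => (1 - t) ^ nbar / (nbar ! : ℝ) := by continuity
  rw [uIcc_of_le zero_le_one]
  refine BIJ88EffectiveAction308.integrableOn_Icc_of_continuousOn_Ioc
    (L := (1 - 0) ^ nbar / (nbar ! : ℝ) * iteratedDeriv (nbar + 1) (cgf (fun ω => -W ω) P) 0) ?_ ?_
  · exact hpoly.continuousOn.mul
      (BIJ88EffectiveAction308.continuousOn_iteratedDeriv_log_restrictedInteraction χ p P B hΦ hcne hW hK hek hek1 hz (nbar + 1))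
  · exact ((hpoly.tendsto 0).mono_left nhdsWithin_le_nhds).mul
      (tendsto_iteratedDeriv_log_restrictedInteraction_cgf_of_L1 χ hp P B hΦ hcpos hW hK hek hL1 (nbar + 1))

/-- **(5.14.1)–(5.14.2) WITH A PROPER REMAINDER INTEGRAL, UNDER `hL1`**: `−log z₁ = pertPart n̄ (cgf_{−W}) − ∫₀¹ ((1−t)^{n̄}/n̄!)·(d/dt)^{n̄+1} log z_t dt`
(probability measure, measurable fields, `c_b ≥ c₀ > 0`, `p > 0`, measurable `|W| ≤ K`, `0 < e_k < e^{−1}`, `z_t ≠ 0` on `(0,1]`) — gen 8's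
`BIJ88EffectiveAction308.effectiveAction_restrictedInteraction_of_ne_zero` without any Gaussian hypothesis: the Taylor formula on `[0,1]` of
`BIJ88RestrictionsL1Decay308.taylor_logz_restrictedInteraction_of_L1` (within-derivatives, equal to the ordinary ones on `(0,1]`) and
`pertP_restrictedInteraction_of_L1`. [cite: BalabanImbrieJaffe1988, (5.14.2) p.308] -/
theorem effectiveAction_restrictedInteraction_of_L1 {p : ℝ} (hp : 0 < p) (P : Measure Ω) [IsProbabilityMeasure P]
    (B : Finset ι) {Φ : ι → Ω → ℝ} (hΦ : ∀ b ∈ B, Measurable (Φ b)) {c : ι → ℝ} {c₀ : ℝ} (hc₀ : 0 < c₀) (hcb : ∀ b ∈ B, c₀ ≤ c b)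
    {W : Ω → ℝ} (hW : Measurable W) {K : ℝ} (hK : ∀ ω, |W ω| ≤ K) {ek : ℝ} (hek : 0 < ek) (hek1 : ek < Real.exp (-1))
    (hz : ∀ t ∈ Set.Ioc (0 : ℝ) 1, (∫ ω, (∏ b ∈ B, cutoff χ (c b * pLog p (t * ek)) (Φ b ω)) * Real.exp (-(t * W ω)) ∂P) ≠ 0)
    (hL1 : ∀ i, 1 ≤ i → Tendsto (fun t => ∫ ω, |iteratedDeriv i (fun s => ∏ b ∈ B, cutoff χ (c b * pLog p (s * ek)) (Φ b ω)) t| ∂P)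
      (𝓝[>] (0 : ℝ)) (𝓝 0)) (nbar : ℕ) :
    -Real.log (∫ ω, (∏ b ∈ B, cutoff χ (c b * pLog p (1 * ek)) (Φ b ω)) * Real.exp (-(1 * W ω)) ∂P) =
      pertPart nbar (cgf (fun ω => -W ω) P) -
        ∫ t in (0 : ℝ)..1, ((1 - t) ^ nbar / (nbar ! : ℝ)) * iteratedDeriv (nbar + 1) (fun t => Real.log
          (∫ ω, (∏ b ∈ B, cutoff χ (c b * pLog p (t * ek)) (Φ b ω)) * Real.exp (-(t * W ω)) ∂P)) t := by
  have hcne : ∀ b ∈ B, c b ≠ 0 := fun b hb => (hc₀.trans_le (hcb b hb)).ne'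
  have hT := taylor_logz_restrictedInteraction_of_L1 χ hp P B hΦ hc₀ hcb hW hK hek hek1 hz hL1 nbar
  rw [pertP_restrictedInteraction_of_L1 χ hp P B hΦ hc₀ hcb hW hK hek hek1 hz hL1 nbar] at hT
  -- the within-`[0,1]` derivative equals the ordinary one on `(0,1]`, i.e. a.e. on the interval of integration
  have hI : (∫ t in (0 : ℝ)..1, ((1 - t) ^ nbar / (nbar ! : ℝ)) * iteratedDerivWithin (nbar + 1) (fun t => Real.log
          (∫ ω, (∏ b ∈ B, cutoff χ (c b * pLog p (t * ek)) (Φ b ω)) * Real.exp (-(t * W ω)) ∂P)) (Set.uIcc 0 1) t) =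
      ∫ t in (0 : ℝ)..1, ((1 - t) ^ nbar / (nbar ! : ℝ)) * iteratedDeriv (nbar + 1) (fun t => Real.log
          (∫ ω, (∏ b ∈ B, cutoff χ (c b * pLog p (t * ek)) (Φ b ω)) * Real.exp (-(t * W ω)) ∂P)) t := by
    refine intervalIntegral.integral_congr_ae (Filter.Eventually.of_forall fun t ht => ?_)
    rw [Set.uIoc_of_le zero_le_one] at ht
    rw [Set.uIcc_of_le zero_le_one,
      BIJ88PertTerms5141.iteratedDerivWithin_Icc_log_restrictedInteraction χ p P B hΦ hcne hW hK hek hek1 hz (nbar + 1) ht]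
  rw [hI] at hT
  linarith

/-- **The improper form of the remainder, under `hL1`**: `∫_a^1 ((1−t)^{n̄}/n̄!)(d/dt)^{n̄+1} log z_t dt → log z₁ + pertPart n̄ (cgf_{−W})` as `a → 0⁺`
(gen 8's `tendsto_remainder_restrictedInteraction'` without centring; hypotheses as above). [cite: BalabanImbrieJaffe1988, (5.14.2) p.308] -/
theorem tendsto_remainder_restrictedInteraction_of_L1 {p : ℝ} (hp : 0 < p) (P : Measure Ω) [IsProbabilityMeasure P]
    (B : Finset ι) {Φ : ι → Ω → ℝ} (hΦ : ∀ b ∈ B, Measurable (Φ b)) {c : ι → ℝ} {c₀ : ℝ} (hc₀ : 0 < c₀) (hcb : ∀ b ∈ B, c₀ ≤ c b)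
    {W : Ω → ℝ} (hW : Measurable W) {K : ℝ} (hK : ∀ ω, |W ω| ≤ K) {ek : ℝ} (hek : 0 < ek) (hek1 : ek < Real.exp (-1))
    (hz : ∀ t ∈ Set.Ioc (0 : ℝ) 1, (∫ ω, (∏ b ∈ B, cutoff χ (c b * pLog p (t * ek)) (Φ b ω)) * Real.exp (-(t * W ω)) ∂P) ≠ 0)
    (hL1 : ∀ i, 1 ≤ i → Tendsto (fun t => ∫ ω, |iteratedDeriv i (fun s => ∏ b ∈ B, cutoff χ (c b * pLog p (s * ek)) (Φ b ω)) t| ∂P)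
      (𝓝[>] (0 : ℝ)) (𝓝 0)) (nbar : ℕ) :
    Tendsto (fun a => ∫ t in a..1, ((1 - t) ^ nbar / (nbar ! : ℝ)) * iteratedDeriv (nbar + 1) (fun t => Real.log
          (∫ ω, (∏ b ∈ B, cutoff χ (c b * pLog p (t * ek)) (Φ b ω)) * Real.exp (-(t * W ω)) ∂P)) t)
      (𝓝[>] (0 : ℝ))
      (𝓝 (Real.log (∫ ω, (∏ b ∈ B, cutoff χ (c b * pLog p (1 * ek)) (Φ b ω)) * Real.exp (-(1 * W ω)) ∂P) +
        pertPart nbar (cgf (fun ω => -W ω) P))) := by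
  set g : ℝ → ℝ := fun t => ((1 - t) ^ nbar / (nbar ! : ℝ)) * iteratedDeriv (nbar + 1) (fun t => Real.log
          (∫ ω, (∏ b ∈ B, cutoff χ (c b * pLog p (t * ek)) (Φ b ω)) * Real.exp (-(t * W ω)) ∂P)) t with hg
  have hint := integrableOn_remainderDensity_of_L1 χ hp P B hΦ hc₀ hcb hW hK hek hek1 hz hL1 nbar
  have hE := effectiveAction_restrictedInteraction_of_L1 χ hp P B hΦ hc₀ hcb hW hK hek hek1 hz hL1 nbar
  -- a ↦ ∫_0^a g is continuous on [0,1] with value 0 at 0, and ∫_a^1 g = ∫_0^1 g − ∫_0^a g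
  have hcont : ContinuousOn (fun a => ∫ t in (0 : ℝ)..a, g t) (uIcc (0 : ℝ) 1) := continuousOn_primitive_interval hint
  have h0lim : Tendsto (fun a => ∫ t in (0 : ℝ)..a, g t) (𝓝[>] (0 : ℝ)) (𝓝 0) := by
    have h := (hcont 0 left_mem_uIcc).tendsto
    rw [intervalIntegral.integral_same] at h
    have h' : Tendsto (fun a => ∫ t in (0 : ℝ)..a, g t) (𝓝[Set.Ioo 0 1] (0 : ℝ)) (𝓝 0) :=
      h.mono_left (nhdsWithin_mono _ (by rw [uIcc_of_le zero_le_one]; exact Ioo_subset_Icc_self))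
    rwa [nhdsWithin_Ioo_eq_nhdsGT zero_lt_one] at h'
  have hsplit : ∀ᶠ a in 𝓝[>] (0 : ℝ), (∫ t in a..1, g t) = (∫ t in (0 : ℝ)..1, g t) - ∫ t in (0 : ℝ)..a, g t := by
    have h1 : ∀ᶠ a in 𝓝[>] (0 : ℝ), a < 1 :=
      (tendsto_id.mono_left nhdsWithin_le_nhds).eventually (gt_mem_nhds zero_lt_one)
    filter_upwards [h1, eventually_nhdsWithin_of_forall fun a (ha : a ∈ Set.Ioi (0 : ℝ)) => ha] with a ha1 ha0
    have hI1 : IntervalIntegrable g volume 0 a :=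
      (hint.mono_set (by rw [uIcc_of_le zero_le_one, uIcc_of_le ha0.le]; exact Icc_subset_Icc le_rfl ha1.le)).intervalIntegrable
    have hI2 : IntervalIntegrable g volume a 1 :=
      (hint.mono_set (by rw [uIcc_of_le zero_le_one, uIcc_of_le ha1.le]; exact Icc_subset_Icc ha0.le le_rfl)).intervalIntegrable
    have h := intervalIntegral.integral_add_adjacent_intervals hI1 hI2
    linarith
  have hlim : Tendsto (fun a => ∫ t in a..1, g t) (𝓝[>] (0 : ℝ)) (𝓝 ((∫ t in (0 : ℝ)..1, g t) - 0)) :=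
    (tendsto_const_nhds.sub h0lim).congr' (hsplit.mono fun a h => h.symm)
  rw [sub_zero] at hlim
  have hval : (∫ t in (0 : ℝ)..1, g t) =
      Real.log (∫ ω, (∏ b ∈ B, cutoff χ (c b * pLog p (1 * ek)) (Φ b ω)) * Real.exp (-(1 * W ω)) ∂P) +
        pertPart nbar (cgf (fun ω => -W ω) P) := by
    rw [hg]; linarith
  rwa [hval] at hlim

end L1

/-! ## §2 Non-centred Gaussian fields -/

section Gaussian

variable (χ : CutoffProfile) {ι Ω : Type*} [MeasurableSpace Ω]

/-- **(5.14.1)–(5.14.2) with a proper remainder integral FOR FIELDS WITH GAUSSIAN LAWS OF ANY MEANS** (`p > 1/2`, Gaussian-law marginals — Mathlib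
`HasGaussianLaw`, no centring, no variance hypothesis —, `c_b ≥ c₀ > 0`, measurable `|W| ≤ K`, `0 < e_k < e^{−1}`, `z_t ≠ 0` on `(0,1]`):
`−log z₁ = pertPart n̄ (cgf_{−W}) − ∫₀¹ ((1−t)^{n̄}/n̄!)(d/dt)^{n̄+1} log z_t dt` — gen 8's `effectiveAction_restrictedInteraction_of_ne_zero` with `h0`, `hvar`
deleted (`hL1` from `BIJ88GaussShellNoncentred309`). [cite: BalabanImbrieJaffe1988, (5.14.2) p.308] -/
theorem effectiveAction_restrictedInteraction_of_hasGaussianLaw {p : ℝ} (hp : 1 / 2 < p) (P : Measure Ω) [IsProbabilityMeasure P]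
    (B : Finset ι) {Φ : ι → Ω → ℝ} (hG : ∀ b ∈ B, HasGaussianLaw (Φ b) P) (hΦ : ∀ b ∈ B, Measurable (Φ b)) {c : ι → ℝ} {c₀ : ℝ}
    (hc₀ : 0 < c₀) (hcb : ∀ b ∈ B, c₀ ≤ c b) {W : Ω → ℝ} (hW : Measurable W) {K : ℝ} (hK : ∀ ω, |W ω| ≤ K) {ek : ℝ} (hek : 0 < ek)
    (hek1 : ek < Real.exp (-1))
    (hz : ∀ t ∈ Set.Ioc (0 : ℝ) 1, (∫ ω, (∏ b ∈ B, cutoff χ (c b * pLog p (t * ek)) (Φ b ω)) * Real.exp (-(t * W ω)) ∂P) ≠ 0)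
    (nbar : ℕ) :
    -Real.log (∫ ω, (∏ b ∈ B, cutoff χ (c b * pLog p (1 * ek)) (Φ b ω)) * Real.exp (-(1 * W ω)) ∂P) =
      pertPart nbar (cgf (fun ω => -W ω) P) -
        ∫ t in (0 : ℝ)..1, ((1 - t) ^ nbar / (nbar ! : ℝ)) * iteratedDeriv (nbar + 1) (fun t => Real.log
          (∫ ω, (∏ b ∈ B, cutoff χ (c b * pLog p (t * ek)) (Φ b ω)) * Real.exp (-(t * W ω)) ∂P)) t :=
  effectiveAction_restrictedInteraction_of_L1 χ (by linarith) P B hΦ hc₀ hcb hW hK hek hek1 hz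
    (fun _ hi => tendsto_integral_abs_iteratedDeriv_prod_cutoff_t_zero_of_hasGaussianLaw χ hp P B hG hΦ hc₀
      (fun b hb => (hcb b hb).trans (le_abs_self _)) hek hi) nbar

/-- **(5.14.1)–(5.14.2) OUTRIGHT FOR NON-CENTRED JOINTLY GAUSSIAN FIELDS WITH MEANS IN THE SMALL-FIELD BOX**: `χ ≥ 0`, `p > 1/2`, jointly Gaussian
fields (`HasGaussianLaw` of `ω ↦ (Φ_b ω)_{b∈Λ}`) with `|E Φ_b| < (9/10)c₀`, `c_b ≥ c₀ > 0`, measurable `|W| ≤ K`, `0 < e_k < e^{−1}`, every `n̄`: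
`−log z₁ = pertPart n̄ (cgf_{−W}) − ∫₀¹ ((1−t)^{n̄}/n̄!)(d/dt)^{n̄+1} log z_t dt` and the remainder density is integrable on `[0,1]` — gen 8's
`BIJ88EffectiveAction308.effectiveAction_restrictedInteraction` / `integrableOn_remainderDensity'` with `h0` replaced by the box condition on the means.
[cite: BalabanImbrieJaffe1988, (5.14.2) p.308] -/
theorem effectiveAction_restrictedInteraction_of_mean (hχ : ∀ x, 0 ≤ χ.χ₁ x) {p : ℝ} (hp : 1 / 2 < p) (P : Measure Ω)
    [IsProbabilityMeasure P] (B : Finset ι) {Φ : ι → Ω → ℝ} (hJ : HasGaussianLaw (fun ω (b : B) => Φ b ω) P)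
    (hΦ : ∀ b ∈ B, Measurable (Φ b)) {c : ι → ℝ} {c₀ : ℝ} (hc₀ : 0 < c₀) (hcb : ∀ b ∈ B, c₀ ≤ c b)
    (hm : ∀ b ∈ B, |P[Φ b]| < 9 / 10 * c₀) {W : Ω → ℝ} (hW : Measurable W) {K : ℝ} (hK : ∀ ω, |W ω| ≤ K) {ek : ℝ} (hek : 0 < ek)
    (hek1 : ek < Real.exp (-1)) (nbar : ℕ) :
    -Real.log (∫ ω, (∏ b ∈ B, cutoff χ (c b * pLog p (1 * ek)) (Φ b ω)) * Real.exp (-(1 * W ω)) ∂P) =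
      pertPart nbar (cgf (fun ω => -W ω) P) -
        ∫ t in (0 : ℝ)..1, ((1 - t) ^ nbar / (nbar ! : ℝ)) * iteratedDeriv (nbar + 1) (fun t => Real.log
          (∫ ω, (∏ b ∈ B, cutoff χ (c b * pLog p (t * ek)) (Φ b ω)) * Real.exp (-(t * W ω)) ∂P)) t ∧
    IntegrableOn (fun t => ((1 - t) ^ nbar / (nbar ! : ℝ)) * iteratedDeriv (nbar + 1) (fun t => Real.log
        (∫ ω, (∏ b ∈ B, cutoff χ (c b * pLog p (t * ek)) (Φ b ω)) * Real.exp (-(t * W ω)) ∂P)) t) (uIcc (0 : ℝ) 1) := by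
  have hz := integral_restrictedInteraction_ne_zero_Ioc_of_mean χ hχ (by linarith : (0 : ℝ) ≤ p) P B hJ hΦ hc₀ hcb hm hW hK hek hek1.le
  have hL1 : ∀ i, 1 ≤ i → Tendsto (fun t => ∫ ω, |iteratedDeriv i (fun s => ∏ b ∈ B, cutoff χ (c b * pLog p (s * ek)) (Φ b ω)) t| ∂P)
      (𝓝[>] (0 : ℝ)) (𝓝 0) := fun _ hi =>
    tendsto_integral_abs_iteratedDeriv_prod_cutoff_t_zero_of_hasGaussianLaw χ hp P B (BIJ88ZtPositivity308.hasGaussianLaw_of_joint P B hJ) hΦ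
      hc₀ (fun b hb => (hcb b hb).trans (le_abs_self _)) hek hi
  exact ⟨effectiveAction_restrictedInteraction_of_L1 χ (by linarith) P B hΦ hc₀ hcb hW hK hek hek1 hz hL1 nbar,
    integrableOn_remainderDensity_of_L1 χ (by linarith) P B hΦ hc₀ hcb hW hK hek hek1 hz hL1 nbar⟩

end Gaussian

end Literature.MathematicalPhysics.QuantumFieldTheory.BalabanImbrieJaffe1984to88.BIJ88EffectiveActionL1Remainder308
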